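import Mathlib

/-!
# Injectivity of the two-sided Laplace transform (support lemma for `DetectorRigidity`, stub 2)

Route `UniversalDetector`, lever crux `DetectorRigidity` (stmt-QuantumFields-26595), ideator seat ym-idea-8 g4.
If a measurable `ρ : V → ℝ` on a finite-dimensional real inner product space has all real exponential moments
`u ↦ exp ⟪v,u⟫ ρ(u)` integrable and VANISHING, then `ρ = 0` at every continuity point.  Route of proof: split
`ρ = ρ⁺ - ρ⁻`; the finite measures `ρ^± du` have equal moment-generating functions along every direction `ξ`, hence
(Mathlib's analytic continuation `ProbabilityTheory.eqOn_complexMGF_of_mgf'`) equal complex MGFs on the whole strip,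
in particular at `z = I`: so `∫ e^{i⟪ξ,u⟫} ρ(u) du = 0` for all `ξ`, i.e. `𝓕 ρ = 0`, and Fourier inversion at a
continuity point (`MeasureTheory.Integrable.fourierInv_fourier_eq`) gives `ρ u₀ = 0`.
Used by `UniversalDetectorGaussDeconv.lean` (the Gaussian-deconvolution stub `Stmt_gaussDeconv`). No summit, leg or
spine crux is proved here.
-/

set_option autoImplicit false

noncomputable section

open MeasureTheory ProbabilityTheory Complex Filter Set
open scoped RealInnerProductSpace FourierTransform ENNReal

namespace Summit.QuantumFields.YangMills.Cruxes.DetectorRigidity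

variable {V : Type*} [NormedAddCommGroup V] [InnerProductSpace ℝ V] [FiniteDimensional ℝ V]
  [MeasurableSpace V] [BorelSpace V]

/-- Auxiliary: transport of `withDensity = 0` between two non-negative integrable densities of
equal total mass. -/
private theorem withDensity_ofReal_eq_zero_of_integral_eq {f g : V → ℝ}
    (hf : ∀ u, 0 ≤ f u) (hg : ∀ u, 0 ≤ g u) (hfm : Measurable f) (hgm : Measurable g)
    (hgi : Integrable g) (hmass : ∫ u, f u = ∫ u, g u)
    (h0 : (volume : Measure V).withDensity (fun u => ENNReal.ofReal (f u)) = 0) :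
    (volume : Measure V).withDensity (fun u => ENNReal.ofReal (g u)) = 0 := by
  rw [withDensity_eq_zero_iff hgm.ennreal_ofReal.aemeasurable]
  rw [withDensity_eq_zero_iff hfm.ennreal_ofReal.aemeasurable] at h0
  have hf0 : f =ᵐ[volume] 0 := by
    filter_upwards [h0] with u hu
    have : ENNReal.ofReal (f u) = 0 := hu
    rw [ENNReal.ofReal_eq_zero] at this
    exact le_antisymm this (hf u)
  have hintf : ∫ u, f u = 0 := by
    rw [integral_congr_ae hf0]; simp
  have hintg : ∫ u, g u = 0 := by rw [← hmass, hintf]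
  have hg0 : g =ᵐ[volume] 0 :=
    (integral_eq_zero_iff_of_nonneg_ae (Eventually.of_forall hg) hgi).mp hintg
  filter_upwards [hg0] with u hu
  simp [hu]

/-- **Vanishing Laplace transform ⇒ vanishing characteristic integrals.** -/
theorem integral_cexp_mul_eq_zero_of_laplace_eq_zero {ρ : V → ℝ} (hρ : Measurable ρ)
    (hi : ∀ v : V, Integrable (fun u => Real.exp ⟪v, u⟫ * ρ u))
    (h0 : ∀ v : V, ∫ u, Real.exp ⟪v, u⟫ * ρ u = 0) (ξ : V) :
    ∫ u, (ρ u : ℂ) * cexp ((⟪ξ, u⟫ : ℝ) * I) = 0 := by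
  classical
  -- positive / negative parts
  set ρp : V → ℝ := fun u => max (ρ u) 0 with hρp_def
  set ρn : V → ℝ := fun u => max (-ρ u) 0 with hρn_def
  have hρp_m : Measurable ρp := hρ.max measurable_const
  have hρn_m : Measurable ρn := hρ.neg.max measurable_const
  have hρp_nn : ∀ u, 0 ≤ ρp u := fun u => le_max_right _ _
  have hρn_nn : ∀ u, 0 ≤ ρn u := fun u => le_max_right _ _
  have hρ_eq : ∀ u, ρ u = ρp u - ρn u := fun u => by
    simp only [hρp_def, hρn_def]
    rcases le_total 0 (ρ u) with h | h
    · rw [max_eq_left h, max_eq_right (by linarith)]; ring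
    · rw [max_eq_right h, max_eq_left (by linarith)]; ring
  have hρp_le : ∀ u, |ρp u| ≤ |ρ u| := fun u => by
    rw [abs_of_nonneg (hρp_nn u)]
    exact max_le (le_abs_self _) (abs_nonneg _)
  have hρn_le : ∀ u, |ρn u| ≤ |ρ u| := fun u => by
    rw [abs_of_nonneg (hρn_nn u)]
    exact max_le (neg_le_abs _) (abs_nonneg _)
  have hXc : Continuous fun u : V => ⟪ξ, u⟫ := continuous_const.inner continuous_id
  have hρi : Integrable ρ := by simpa using hi 0
  -- exp-weighted integrability of the parts
  have hint : ∀ (t : ℝ) (g : V → ℝ), Measurable g → (∀ u, |g u| ≤ |ρ u|) →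
      Integrable (fun u => g u * Real.exp (t * ⟪ξ, u⟫)) := by
    intro t g hg hle
    refine (hi (t • ξ)).norm.mono'
      ((hg.mul (Real.continuous_exp.comp (continuous_const.mul hXc)).measurable).aestronglyMeasurable)
      (Eventually.of_forall fun u => ?_)
    rw [norm_mul, Real.norm_eq_abs, Real.norm_eq_abs, abs_of_pos (Real.exp_pos _), norm_mul,
      Real.norm_eq_abs, Real.norm_eq_abs, abs_of_pos (Real.exp_pos _), real_inner_smul_left]
    rw [mul_comm]
    exact mul_le_mul_of_nonneg_left (hle u) (Real.exp_pos _).le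
  -- the two finite measures
  set μp : Measure V := volume.withDensity fun u => ENNReal.ofReal (ρp u) with hμp_def
  set μn : Measure V := volume.withDensity fun u => ENNReal.ofReal (ρn u) with hμn_def
  have hfm_p : Measurable fun u => ENNReal.ofReal (ρp u) := ENNReal.measurable_ofReal.comp hρp_m
  have hfm_n : Measurable fun u => ENNReal.ofReal (ρn u) := ENNReal.measurable_ofReal.comp hρn_m
  have hlt_p : ∀ᵐ u ∂(volume : Measure V), ENNReal.ofReal (ρp u) < (⊤ : ℝ≥0∞) :=
    Eventually.of_forall fun _ => ENNReal.ofReal_lt_top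
  have hlt_n : ∀ᵐ u ∂(volume : Measure V), ENNReal.ofReal (ρn u) < (⊤ : ℝ≥0∞) :=
    Eventually.of_forall fun _ => ENNReal.ofReal_lt_top
  have hIp : ∀ {E : Type} [NormedAddCommGroup E] [NormedSpace ℝ E] (g : V → E),
      ∫ u, g u ∂μp = ∫ u, ρp u • g u := by
    intro E _ _ g
    rw [hμp_def, integral_withDensity_eq_integral_toReal_smul hfm_p hlt_p]
    refine integral_congr_ae (Eventually.of_forall fun u => ?_)
    simp [ENNReal.toReal_ofReal (hρp_nn u)]
  have hIn : ∀ {E : Type} [NormedAddCommGroup E] [NormedSpace ℝ E] (g : V → E),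
      ∫ u, g u ∂μn = ∫ u, ρn u • g u := by
    intro E _ _ g
    rw [hμn_def, integral_withDensity_eq_integral_toReal_smul hfm_n hlt_n]
    refine integral_congr_ae (Eventually.of_forall fun u => ?_)
    simp [ENNReal.toReal_ofReal (hρn_nn u)]
  set X : V → ℝ := fun u => ⟪ξ, u⟫ with hX_def
  -- equal moment generating functions
  have hmgf : mgf X μp = mgf X μn := by
    funext t
    simp only [mgf]
    rw [hIp, hIn]
    refine sub_eq_zero.mp ?_
    rw [← integral_sub ((hint t ρp hρp_m hρp_le).congr (Eventually.of_forall fun u => by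
          simp [hX_def, smul_eq_mul]))
        ((hint t ρn hρn_m hρn_le).congr (Eventually.of_forall fun u => by
          simp [hX_def, smul_eq_mul]))]
    have h := h0 (t • ξ)
    rw [← h]
    refine integral_congr_ae (Eventually.of_forall fun u => ?_)
    simp only [smul_eq_mul, hX_def, real_inner_smul_left]
    rw [hρ_eq u]; ring
  -- total masses agree, so `μp = 0 ↔ μn = 0`
  have hmass : ∫ u, ρp u = ∫ u, ρn u := by
    have h := h0 0
    have h' : ∫ u, ρ u = 0 := by simpa using h
    rw [← sub_eq_zero, ← integral_sub (hρi.norm.mono' hρp_m.aestronglyMeasurable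
        (Eventually.of_forall fun u => by simpa using hρp_le u))
      (hρi.norm.mono' hρn_m.aestronglyMeasurable (Eventually.of_forall fun u => by simpa using hρn_le u))]
    rw [← h']
    exact integral_congr_ae (Eventually.of_forall fun u => (hρ_eq u).symm)
  have hρpi : Integrable ρp := hρi.norm.mono' hρp_m.aestronglyMeasurable
    (Eventually.of_forall fun u => by simpa using hρp_le u)
  have hρni : Integrable ρn := hρi.norm.mono' hρn_m.aestronglyMeasurable
    (Eventually.of_forall fun u => by simpa using hρn_le u)
  have hzero : μp = 0 ↔ μn = 0 :=
    ⟨withDensity_ofReal_eq_zero_of_integral_eq hρp_nn hρn_nn hρp_m hρn_m hρni hmass,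
     withDensity_ofReal_eq_zero_of_integral_eq hρn_nn hρp_nn hρn_m hρp_m hρpi hmass.symm⟩
  have hEq := eqOn_complexMGF_of_mgf' hmgf hzero
  -- the strip is everything
  have hset : integrableExpSet X μp = Set.univ := by
    refine Set.eq_univ_of_forall fun t => ?_
    change Integrable (fun u => Real.exp (t * X u)) μp
    rw [hμp_def, integrable_withDensity_iff_integrable_smul' hfm_p hlt_p]
    refine (hint t ρp hρp_m hρp_le).congr (Eventually.of_forall fun u => ?_)
    simp [ENNReal.toReal_ofReal (hρp_nn u), hX_def, smul_eq_mul]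
  have hI : (I : ℂ) ∈ {z : ℂ | z.re ∈ interior (integrableExpSet X μp)} := by
    simp [hset]
  have hC := hEq hI
  simp only [complexMGF] at hC
  rw [hIp, hIn] at hC
  -- assemble
  have hip : Integrable (fun u => (ρp u : ℂ) * cexp ((⟪ξ, u⟫ : ℝ) * I)) := by
    refine hρi.norm.mono' ?_ (Eventually.of_forall fun u => ?_)
    · exact ((Complex.continuous_ofReal.measurable.comp hρp_m).mul
        (Complex.continuous_exp.measurable.comp
          ((Complex.continuous_ofReal.measurable.comp hXc.measurable).mul_const I))).aestronglyMeasurable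
    · rw [norm_mul, Complex.norm_real, Complex.norm_exp_ofReal_mul_I, mul_one]
      simpa using hρp_le u
  have hin : Integrable (fun u => (ρn u : ℂ) * cexp ((⟪ξ, u⟫ : ℝ) * I)) := by
    refine hρi.norm.mono' ?_ (Eventually.of_forall fun u => ?_)
    · exact ((Complex.continuous_ofReal.measurable.comp hρn_m).mul
        (Complex.continuous_exp.measurable.comp
          ((Complex.continuous_ofReal.measurable.comp hXc.measurable).mul_const I))).aestronglyMeasurable
    · rw [norm_mul, Complex.norm_real, Complex.norm_exp_ofReal_mul_I, mul_one]
      simpa using hρn_le u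
  have hsplit : (fun u => (ρ u : ℂ) * cexp ((⟪ξ, u⟫ : ℝ) * I)) =
      fun u => (ρp u : ℂ) * cexp ((⟪ξ, u⟫ : ℝ) * I) - (ρn u : ℂ) * cexp ((⟪ξ, u⟫ : ℝ) * I) := by
    funext u; rw [hρ_eq u]; push_cast; ring
  rw [hsplit, integral_sub hip hin, sub_eq_zero]
  have e1 : ∫ u, (ρp u : ℂ) * cexp ((⟪ξ, u⟫ : ℝ) * I) = ∫ u, ρp u • cexp (I * (X u : ℂ)) :=
    integral_congr_ae (Eventually.of_forall fun u => by
      simp only [hX_def, Complex.real_smul, mul_comm I])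
  have e2 : ∫ u, (ρn u : ℂ) * cexp ((⟪ξ, u⟫ : ℝ) * I) = ∫ u, ρn u • cexp (I * (X u : ℂ)) :=
    integral_congr_ae (Eventually.of_forall fun u => by
      simp only [hX_def, Complex.real_smul, mul_comm I])
  rw [e1, e2]
  exact hC

/-- **Injectivity of the two-sided Laplace transform at continuity points.** -/
theorem eq_zero_of_laplace_eq_zero {ρ : V → ℝ} (hρ : Measurable ρ)
    (hi : ∀ v : V, Integrable (fun u => Real.exp ⟪v, u⟫ * ρ u))
    (h0 : ∀ v : V, ∫ u, Real.exp ⟪v, u⟫ * ρ u = 0) {u₀ : V} (hc : ContinuousAt ρ u₀) :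
    ρ u₀ = 0 := by
  have hρi : Integrable ρ := by simpa using hi 0
  set f : V → ℂ := fun u => (ρ u : ℂ) with hf_def
  have hf : Integrable f := hρi.ofReal
  have hF : 𝓕 f = 0 := by
    funext w
    rw [Real.fourier_eq']
    have h := integral_cexp_mul_eq_zero_of_laplace_eq_zero hρ hi h0 ((-(2 * Real.pi)) • w)
    have hfun : (fun v => cexp (↑(-2 * Real.pi * ⟪v, w⟫) * I) • f v) =
        fun v => (ρ v : ℂ) * cexp ((⟪(-(2 * Real.pi)) • w, v⟫ : ℝ) * I) := by
      funext v
      rw [smul_eq_mul, mul_comm, hf_def, real_inner_smul_left, real_inner_comm]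
      congr 2
      push_cast
      ring
    rw [hfun, h]
    rfl
  have hFi : Integrable (𝓕 f) := by rw [hF]; exact integrable_zero _ _ _
  have key := hf.fourierInv_fourier_eq hFi (Complex.continuous_ofReal.continuousAt.comp hc)
  rw [hF] at key
  have h0' : (𝓕⁻ (0 : V → ℂ)) u₀ = 0 := by
    rw [Real.fourierInv_eq]; simp
  have h1 : f u₀ = 0 := by rw [← key, h0']
  simp only [hf_def] at h1
  exact_mod_cast h1


end Summit.QuantumFields.YangMills.Cruxes.DetectorRigidity

end
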